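import Mathlib.Analysis.SpecialFunctions.Pow.Real
import Literature.Combinatorics.Additive.TripleProductProperty
import Literature.Computability.AlgebraicComplexity.CohnUmansTPP
import Literature.RepresentationTheory.FiniteGroups.CharacterDegrees
import Literature.RepresentationTheory.FiniteGroups.NonabelianCharDegree
import HarnessLib

/-!
# Barrier: groups whose second-smallest character degree is large — in particular groups of Lie type — cannot give `ω = 2` (Blasiak–Cohn–Grochow–Pratt–Umans 2023)

Topic `Literature/Barriers/MatrixMultiplication` (D-0021 barrier catalogue for the summit
`MatrixMultiplication`, `ω(ℂ) = 2`; group-theoretic approach of Cohn–Umans, non-abelian line —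
the route item `CNonabelianTPPFamilies` of `MatrixMultiplication/GroupTheoreticSTPP` names this
paper's §3 as what candidate families "must evade").

Source: J. Blasiak, H. Cohn, J. A. Grochow, K. Pratt, C. Umans, *Matrix multiplication via matrix
groups*, ITCS 2023, LIPIcs 251, 19:1–19:16, arXiv:2204.03826 (held copy `paper:arxiv-2204.03826`,
read with `lit read`; pages are those of the held 14-page text: §1.1 pp. 3–4, §2 with Def. 2.1,
Thm. 2.2, Def. 2.3 p. 5, §3.1 with Def. 3.1, Thm. 3.2 and its proof, Cor. 3.3, Cor. 3.4 and its
proof p. 6, Cor. 3.5 p. 7). The companion normaliser barrier (Thm. 3.6, Cor. 3.8) is the sibling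
file `NormalizerBarrier.lean` (proved there).

## Catalogue entry

The D-0021 structured block is in the docstring of the catalogue declaration `QuasirandomBarrier`
at the end of this file.

## Content

* `secondCharDegree G = n(G)` (Def. 3.1) on the tree's `charDegrees G`
  (`Literature/RepresentationTheory/FiniteGroups/CharacterDegrees.lean`), with
  `secondCharDegree_le`.
* Named facts (statements only): `BCGPU2023_thm32` (Thm. 3.2), `BCGPU2023_cor35` (Cor. 3.5).
* Proved consequences: `BCGPU2023_thm32.cor33` (Cor. 3.3 in effective form: `n(G) ≥ c|G|^δ`
  forces `|S||T||U| ≤ |G|^{3/2−δ/2}/√c + |G|`), `BCGPU2023_thm32.sub_card_le`, and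
  `BCGPU2023_thm32.cor35`: **Cor. 3.5 derived from Thm. 3.2 alone** (abelian case: Cohn–Umans'
  bound, the tree's `RealizesTPP.mul_mul_le_card` transported as
  `tripleProductProperty_card_le_of_comm`; non-abelian case: `n(G) ≥ 2` or the junk `0`, both
  fine); `two_le_secondCharDegree` records that under Serre's Thm. 9 (`Serre1977_thm9`,
  `NonabelianCharDegree.lean`) `n(G) ≥ 2` for non-abelian `G`.
* Catalogue entry `QuasirandomBarrier : Prop := BCGPU2023_thm32 ∧ BCGPU2023_cor35` with the D-0021
  block and projections.
* Both named facts are PROVED in the sibling file `QuasirandomBarrierProofs.lean`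
  (`BCGPU2023_thm32_holds`, `QuasirandomBarrier_holds`), and the sibling file
  `QuasirandomBarrierSTPP.lean` (barrier audit, 2026-08-15) proves that the printed argument extends
  to simultaneous triple product (STPP) families in PERFECT groups (`BCGPU2023_thm32_stpp`,
  `.packing`, `.sum_rpow_two_thirds_le`); see scope caveats (a), (e) of the catalogue block.

## Design choices and wording risks

* `TripleProductProperty` is the tree's (Cohn–Umans 2003, Def. 2.1, `Finset`s with quotient sets
  `Q(S) = {s s'⁻¹}`); "finite nonabelian group" is `[Fintype G]` with `∃ a b, a * b ≠ b * a`.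
* `n(G)` is a `Nat.sInf`; for non-abelian finite `G` the set `{d ∈ charDegrees G | d > 1}` is
  non-empty (a finite group all of whose irreducible complex representations are one-dimensional
  is abelian: Serre 1977, Thm. 9, the tree's named fact `Serre1977_thm9`; `two_le_secondCharDegree`),
  so no junk value enters Thm. 3.2 as stated; Cor. 3.5 is kept as its own named fact (as printed)
  AND derived from Thm. 3.2 (`BCGPU2023_thm32.cor35`; the derivation does not even need Serre's
  theorem, since in the junk case `n(G) = 0` Thm. 3.2 would read `|S||T||U| ≤ |G|`).
* Cor. 3.4 (groups of Lie type: "There exists a constant `ε > 0` such that no triple product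
  property construction in a group of Lie type can yield an upper bound on `ω` better than
  `2 + ε`") needs the notion of a finite group of Lie type (Chevalley / twisted groups, Malle–
  Testerman Def. 21.6) and the bounds of Landazuri–Seitz (`n(G) ≥ Ω(q^r)`) and Fulman–Guralnick
  (`O(q^r)` conjugacy classes), none of which is in Mathlib or the tree; it is recorded in the
  catalogue block with its cite, not as a Lean statement.  UPDATE (2026-08-27): for the type-`A`
  families `SL(n, q)`, `PSL(n, q)` (every `n ≥ 2`, every `q`, one absolute `ε`) Cor. 3.4 is the
  named fact `BCGPU2023_cor34_typeA` of the sequel `QuasirandomBarrierLieType.lean`, now PROVED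
  (`BCGPU2023_cor34_typeA_holds`, `QuasirandomBarrierLieTypeProofs.lean`: Landazuri–Seitz Lemma 3.1
  for `SL_n(𝔽_q)` is `Literature/RepresentationTheory/FiniteGroups/SLnMinimalCharacterDegree.lean`
  and the class-number input is the elementary `k(GL_n(q)) ≤ (2q)ⁿ` of `GLnClassNumberBound.lean`);
  the §3.2 remarks on the full linear groups (`GL(n, q)`: subgroups and arbitrary subsets cannot
  meet the packing bound; no certificate below `2 + ε` in any `GL(n, q)`) are PROVED in
  `QuasirandomBarrierGLn.lean`; `Sp(2n, q)` is expressible as `Matrix.symplecticGroup (Fin n) F`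
  (sequel `QuasirandomBarrierLieTypeC.lean`, named fact `BCGPU2023_cor34_typeC`; UPDATE 2026-08-27:
  its BOUNDED-RANK half is PROVED — `BCGPU2023_noCertificate_Sp_rank_le`, one `ε(N)` for all
  `Sp(2n,q)`, `PSp(2n,q)`, `n ≤ N` — and the fact itself is reduced to the Fulman–Guralnick
  class-number input alone, `BCGPU2023_cor34_typeC_of_classNumber`, both in
  `QuasirandomBarrierLieTypeCOfClassNumber.lean`, the Landazuri–Seitz-type input being proved in
  `Literature/RepresentationTheory/FiniteGroups/SpMinimalCharacterDegree.lean`); the remaining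
  families (`SU`, `SO`, `Ω`, exceptional, Suzuki–Ree) still have no Mathlib carrier.
-/

noncomputable section

open scoped BigOperators

namespace Literature.Barriers.MatrixMultiplication

open Literature.RepresentationTheory.FiniteGroups Literature.Combinatorics.Additive

/-- **`n(G)`, the second-smallest character degree** (BCGPU 2023, Def. 3.1: "For a finite
nonabelian group `G`, let `n(G) := min_{π ∈ Irr(G) : dim π > 1} dim π` be the smallest dimension of
an irreducible representation of `G` of dimension greater than `1`"), on the tree's `charDegrees G`
(`CharacterDegrees.lean`). A `Nat.sInf`: for abelian `G` (no such `π`) the value is the junk `0`;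
for non-abelian finite `G` the set is non-empty and `n(G) ≥ 2`.
[cite: BlasiakCohnGrochowPrattUmans2023, Def. 3.1] -/
def secondCharDegree (G : Type) [Group G] : ℕ :=
  sInf {d : ℕ | d ∈ charDegrees G ∧ 1 < d}

/-- If some irreducible representation has dimension `d > 1` then `2 ≤ n(G) ≤ d`. [folklore] -/
theorem secondCharDegree_le {G : Type} [Group G] {d : ℕ} (hd : d ∈ charDegrees G) (h1 : 1 < d) :
    2 ≤ secondCharDegree G ∧ secondCharDegree G ≤ d := by
  have hne : {d : ℕ | d ∈ charDegrees G ∧ 1 < d}.Nonempty := ⟨d, hd, h1⟩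
  refine ⟨?_, Nat.sInf_le ⟨hd, h1⟩⟩
  have hmem := Nat.sInf_mem hne
  exact hmem.2

/-! ## Named facts -/

/-- **BCGPU 2023, Theorem 3.2** (p. 6: "If subsets `S`, `T`, and `U` satisfy the triple product
property in a finite nonabelian group `G`, then `|S||T||U| ≤ |G|^{3/2}/n(G)^{1/2} + |G|`"), with
`n(G) = secondCharDegree G` and the tree's `TripleProductProperty` (Cohn–Umans 2003, Def. 2.1).
Proof in print: Fourier inversion on `1_S * 1_{S⁻¹} * 1_T * 1_{T⁻¹} * 1_U * 1_{U⁻¹}` at `1`,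
non-abelian Parseval and Cauchy–Schwarz, "following the Fourier-analytic proof of Gowers' theorem
on mixing in quasirandom groups". [cite: BlasiakCohnGrochowPrattUmans2023, Thm. 3.2] -/
def BCGPU2023_thm32 : Prop :=
  ∀ (G : Type) [Group G] [Fintype G], (∃ a b : G, a * b ≠ b * a) →
    ∀ (S T U : Finset G), TripleProductProperty S T U →
      ((S.card * T.card * U.card : ℕ) : ℝ) ≤
        (Fintype.card G : ℝ) ^ (3 / 2 : ℝ) / Real.sqrt (secondCharDegree G) + Fintype.card G

/-- **BCGPU 2023, Corollary 3.5** (p. 7: "If subsets `S`, `T`, and `U` satisfy the triple product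
property in a finite group `G`, then `|S||T||U| ≤ |G|^{3/2}/√2 + |G|"; abelian case by
Cohn–Umans 2003, `|S||T||U| ≤ |G|`, otherwise `n(G) ≥ 2` in Thm. 3.2). Sharpens Cohn–Umans'
`|S||T||U| < |G|^{3/2}`. [cite: BlasiakCohnGrochowPrattUmans2023, Cor. 3.5] -/
def BCGPU2023_cor35 : Prop :=
  ∀ (G : Type) [Group G] [Fintype G] (S T U : Finset G), TripleProductProperty S T U →
    ((S.card * T.card * U.card : ℕ) : ℝ) ≤
      (Fintype.card G : ℝ) ^ (3 / 2 : ℝ) / Real.sqrt 2 + Fintype.card G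

/-! ## Consequences (proved from the facts) -/

/-- **BCGPU 2023, Corollary 3.3, effective form** ("No sequence `G₁, G₂, …` of finite groups
satisfying `n(Gᵢ) ≥ Ω(|Gᵢ|^δ)` with `δ > 0` can meet the packing bound"): under Thm. 3.2, if
`n(G) ≥ c |G|^δ` with `c > 0` then every TPP triple has
`|S||T||U| ≤ |G|^{3/2 − δ/2}/√c + |G|` — bounded away from the packing bound `|G|^{3/2−o(1)}`.
[cite: BlasiakCohnGrochowPrattUmans2023, Cor. 3.3] -/
theorem BCGPU2023_thm32.cor33 (h32 : BCGPU2023_thm32) (G : Type) [Group G] [Fintype G]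
    (hG : ∃ a b : G, a * b ≠ b * a) {c δ : ℝ} (hc : 0 < c)
    (hn : c * (Fintype.card G : ℝ) ^ δ ≤ secondCharDegree G) (S T U : Finset G)
    (hTPP : TripleProductProperty S T U) :
    ((S.card * T.card * U.card : ℕ) : ℝ) ≤
      (Fintype.card G : ℝ) ^ (3 / 2 - δ / 2 : ℝ) / Real.sqrt c + Fintype.card G := by
  have hG0 : (0 : ℝ) < Fintype.card G := Nat.cast_pos.2 Fintype.card_pos
  have hcg : 0 < c * (Fintype.card G : ℝ) ^ δ := mul_pos hc (Real.rpow_pos_of_pos hG0 δ)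
  refine (h32 G hG S T U hTPP).trans (add_le_add_left ?_ _)
  calc (Fintype.card G : ℝ) ^ (3 / 2 : ℝ) / Real.sqrt (secondCharDegree G)
      ≤ (Fintype.card G : ℝ) ^ (3 / 2 : ℝ) / Real.sqrt (c * (Fintype.card G : ℝ) ^ δ) := by
        gcongr
    _ = (Fintype.card G : ℝ) ^ (3 / 2 - δ / 2 : ℝ) / Real.sqrt c := by
        rw [Real.sqrt_mul hc.le, Real.sqrt_eq_rpow ((Fintype.card G : ℝ) ^ δ), ← Real.rpow_mul hG0.le,
          div_mul_eq_div_div, div_right_comm, sub_eq_add_neg (3 / 2 : ℝ), Real.rpow_add hG0,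
          Real.rpow_neg hG0.le]
        ring_nf

/-- The packing-bound reading of Thm. 3.2 for a single group: a TPP triple meeting
`|S||T||U| ≥ |G|^{3/2} / K` forces `n(G) ≤ (K (1 + |G|^{-1/2} … ))²`; precisely, from Thm. 3.2,
`|S||T||U| − |G| ≤ |G|^{3/2}/√n(G)`. [cite: BlasiakCohnGrochowPrattUmans2023, Thm. 3.2] -/
theorem BCGPU2023_thm32.sub_card_le (h32 : BCGPU2023_thm32) (G : Type) [Group G] [Fintype G]
    (hG : ∃ a b : G, a * b ≠ b * a) (S T U : Finset G) (hTPP : TripleProductProperty S T U) :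
    ((S.card * T.card * U.card : ℕ) : ℝ) - Fintype.card G ≤
      (Fintype.card G : ℝ) ^ (3 / 2 : ℝ) / Real.sqrt (secondCharDegree G) := by
  have := h32 G hG S T U hTPP
  linarith

/-! ## Cor. 3.5 derived from Thm. 3.2 (with Cohn–Umans' abelian bound) -/

/-- Cohn–Umans 2003, Lemma 3.1 (abelian groups: `|S||T||U| ≤ |G|` for a TPP triple) — the tree's
`RealizesTPP.mul_mul_le_card` (`CohnUmansTPP.lean`, stated for `[CommGroup G]`), transported to a
`Group` all of whose elements commute (the form in which "`G` abelian" arises below).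
[cite: CohnUmans2003, Lemma 3.1] -/
theorem tripleProductProperty_card_le_of_comm {G : Type*} [Group G] [Fintype G]
    (hcomm : ∀ a b : G, a * b = b * a) {S T U : Finset G} (h : TripleProductProperty S T U) :
    S.card * T.card * U.card ≤ Fintype.card G :=
  have hr : Literature.Computability.AlgebraicComplexity.RealizesTPP G S.card T.card U.card := ⟨S, T, U, rfl, rfl, rfl, h⟩
  @Literature.Computability.AlgebraicComplexity.RealizesTPP.mul_mul_le_card G { toGroup := ‹Group G›, mul_comm := hcomm } _ _ _ _ hr

/-- Under Serre's Thm. 9 (the tree's named fact `Serre1977_thm9`, `NonabelianCharDegree.lean`) a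
finite non-abelian group has `n(G) ≥ 2` — the value of `secondCharDegree` is then never the junk
`0`. [cite: BlasiakCohnGrochowPrattUmans2023, Def. 3.1] -/
theorem two_le_secondCharDegree (h9 : Serre1977_thm9) (G : Type) [Group G] [Finite G]
    (hG : ∃ a b : G, a * b ≠ b * a) : 2 ≤ secondCharDegree G := by
  obtain ⟨d, hd, h1⟩ := h9.exists_one_lt_mem_charDegrees G hG
  exact (secondCharDegree_le hd h1).1

/-- **BCGPU 2023, Cor. 3.5 derived from Thm. 3.2** (as in print: "If `G` is abelian, then
`|S||T||U| ≤ |G|` by [cu2003]. Otherwise `n(G) ≥ 2` and the conclusion follows from Thm. 3.2").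
Formally no representation theory is needed: `secondCharDegree G` is a `Nat.sInf`, hence either
`≥ 2` (the printed case; always, by Serre's Thm. 9 — `two_le_secondCharDegree`) or the junk value
`0` (were there no degree `> 1`), in which case `BCGPU2023_thm32` reads `|S||T||U| ≤ 0 + |G|`
(`√0 = 0`, `x/0 = 0`) and the conclusion holds a fortiori; the abelian case is Cohn–Umans'
Lemma 3.1 (`tripleProductProperty_card_le_of_comm`).
[cite: BlasiakCohnGrochowPrattUmans2023, Cor. 3.5 (proof)] -/
theorem BCGPU2023_thm32.cor35 (h32 : BCGPU2023_thm32) : BCGPU2023_cor35 := by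
  intro G _ _ S T U hTPP
  have hG0 : (0 : ℝ) ≤ (Fintype.card G : ℝ) ^ (3 / 2 : ℝ) / Real.sqrt 2 := by positivity
  by_cases hG : ∃ a b : G, a * b ≠ b * a
  · have h := h32 G hG S T U hTPP
    by_cases hne : {d : ℕ | d ∈ charDegrees G ∧ 1 < d}.Nonempty
    · have h1 : 1 < secondCharDegree G := (Nat.sInf_mem hne).2
      have h2 : (2 : ℝ) ≤ secondCharDegree G := by exact_mod_cast h1
      refine h.trans (add_le_add_left ?_ _)
      gcongr
    · have h0 : secondCharDegree G = 0 := by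
        rw [secondCharDegree, Set.not_nonempty_iff_eq_empty.1 hne, Nat.sInf_empty]
      rw [h0, Nat.cast_zero, Real.sqrt_zero, div_zero, zero_add] at h
      linarith
  · push Not at hG
    have hle : ((S.card * T.card * U.card : ℕ) : ℝ) ≤ Fintype.card G := by
      exact_mod_cast tripleProductProperty_card_le_of_comm hG hTPP
    linarith

/-! ## Catalogue entry (D-0021) -/

section Catalogue

/-- **A large second-smallest character degree obstructs the packing bound; groups of Lie type
cannot give `ω = 2` (Blasiak–Cohn–Grochow–Pratt–Umans 2023, §3.1).** The catalogue entry is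
Thm. 3.2 ∧ Cor. 3.5 (named facts).

BARRIER
technique_class: group-theoretic-approach, Cohn–Umans, triple-product-property constructions `S, T, U ⊆ G` (`TripleProductProperty`, arbitrary subsets) in finite NON-ABELIAN groups with large `n(G)` = second-smallest irreducible character degree (`secondCharDegree`): quasirandom-type groups, finite groups of Lie type (Chevalley, twisted, Suzuki–Ree, and their quotients by the centre: `SL(n,q)`, `SU(n,q)`, `SO(2n+1,q)`, `Sp(2n,q)`, `SO^±(2n,q)`), finite simple groups other than alternating/cyclic/sporadic
blocks: (i) meeting the packing bound `|S||T||U| = |G|^{3/2−o(1)}` (Def. 2.3), necessary for `ω = 2` via the Cohn–Umans inequality `(|S||T||U|)^{ω/3} ≤ ∑ᵢ dᵢ^ω` (Thm. 2.2 = Cohn–Umans 2003 / CKSU Thm. 1.8, the tree's `CKSU2005_thm18`): "If subsets `S`, `T`, and `U` satisfy the triple product property in a finite nonabelian group `G`, then `|S||T||U| ≤ |G|^{3/2}/n(G)^{1/2} + |G|`" (`BCGPU2023_thm32`), hence "No sequence `G₁, G₂, …` of finite groups satisfying `n(Gᵢ) ≥ Ω(|Gᵢ|^δ)` with `δ > 0`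 can meet the packing bound" (`BCGPU2023_thm32.cor33`) [cite: BlasiakCohnGrochowPrattUmans2023, Thm. 3.2 and Cor. 3.3]; (ii) `ω = 2` from groups of Lie type: "There exists a constant `ε > 0` such that no triple product property construction in a group of Lie type can yield an upper bound on `ω` better than `2 + ε`" — "This resolves a question asked in [cu2003]" (the constructions with Lie-type groups of pseudo-exponent approaching `2` in Cohn–Umans 2003, called the "Lie pseudo-exponent two" construction in Blasiak–Church–Cohn–Grochow–Umans 2017, §1) [cite: BlasiakCohnGrochowPrattUmans2023, Cor. 3.4 and §1.1 (p. 3)] [cite: BlasiakChurchCohnGrochowUmans2017, §1]; (iii) for every finite group, `|S||T||U| ≤ |G|^{3/2}/√2 + |G|` (`BCGPU2023_cor35`) [cite: BlasiakCohnGrochowPrattUmans2023, Cor. 3.5]. Constrains the route item `CNonabelianTPPFamilies` (families `G_k` with TPP triples, `|G_k| ≤ n_k^{2+ε}`, `d_max ≤ n_k^{ε}`).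
because: the TPP says `(1_S*1_{S⁻¹}*1_T*1_{T⁻¹}*1_U*1_{U⁻¹})(1) = |S||T||U|`; expanding by Fourier inversion, the one-dimensional representations contribute non-negatively (the trivial one `(|S||T||U|)²`), and the terms with `d_π > 1` are bounded by Cauchy–Schwarz and non-abelian Parseval, using `‖π(S⁻¹T)‖ ≤ (|S||T||G|/n(G))^{1/2}` for `d_π ≥ n(G)`, giving `|G||S||T||U| ≥ (|S||T||U|)² − |S||T||U||G|^{3/2}/n(G)^{1/2}` [cite: BlasiakCohnGrochowPrattUmans2023, Thm. 3.2 (proof)]; for Lie type of rank `r` and dimension `d` over `𝔽_q`: `|G| = Θ(q^d)`, `n(G) ≥ Ω(q^r)` (Landazuri–Seitz), so `|S||T||U| = O(q^{3d/2 − r/2})`, while `O(q^r)` conjugacy classes (Fulman–Guralnick) and convexity give `∑ dᵢ^ω ≥ Ω(q^{r + ω(d−r)/2})`, whence Thm. 2.2 yields at best `ω ≤ 3(r + log_q C)/r`; bounded rank is covered by Cor. 3.3 since then `n(G) ≥ Ω(|G|^δ)` [cite: BlasiakCohnGrochowPrattUmans2023, Cor. 3.4 (proof)].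
evasions_known: direct products: "the direct product of such groups escapes the barrier entirely, since the second-smallest dimension of an irreducible representation of a direct product equals the second-smallest dimension among the irreducible representations of the factors" — e.g. the powers `SL(n,ℝ)^m` of the continuous setting, whose Lie exponent approaches `3` [cite: BlasiakCohnGrochowPrattUmans2023, §1.1 (p. 4) and Thm. 4.9]; abelian and nilpotent/solvable extensions are outside the class (but see the slice-rank barriers [cite: BlasiakChurchCohnGrochowNaslundSawinUmans2017, Thm. B] [cite: BlasiakChurchCohnGrochowUmans2017, Thm. 3.19]); the paper proposes Lie groups (the "Lie exponent" `ω(G)` of Def. 4.1, Question 4.2) as an intermediate target where constructions meeting the packing bound exist, although subvarieties of an algebraic group over an algebraically closed field cannot help (Thm. 4.7) [cite: BlasiakCohnGrochowPrattUmans2023, §1.1 (p. 4) and §4 (Def. 4.1, Question 4.2, Thm. 4.7)]; the DIAGONAL regime of powers of Lie-type groups is posed as open by the authors themselves: "It follows from [Sawin 2018] that triple product property constructions inside `SL(2,q)^m` cannot give `ω = 2` for fixed `q` and growing `m`, and Theorem 3.2 shows that `SL(n,q)^m` cannot give `ω = 2` for fixed `m` and growing `q`. … Is there a common generalization of these two facts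 that would rule out obtaining `ω = 2` with `m` and `q` both growing?" (kernel form of both printed premises, 2026-08-27: `not_meetsPackingBound_SL_pow` / `exists_eps_noCertificate_SL_pow` for `m` fixed and `exists_eps_noCertificate_SL_pow_fixed_field` for `q` fixed, `QuasirandomBarrierPowersAlternating.lean`; Thm. 3.2 saves only the factor `√n(SL(n,q)) = |G|^{O(1/m)}` there, and Sawin's bound for groups with a normal `PSL(2,p)^m`, `p > 3` prime — multiplicative matchings have density `≤ δ_p^m` with "`lim_{p → ∞} δ_p ≈ .919`" — only the factor `δ_p^{-m} = |G|^{O(1/log p)}`) [cite: BlasiakCohnGrochowPrattUmans2023, §5 (p. 12)] [cite: Sawin2018, Thm. 3.10 (= Thm. stated in §1, p. 2)]; repeated in the sequel: "possibilities remain open to use related groups such as direct products of finite groups of Lie type" [cite: BlasiakCohnGrochowPrattUmans2024, §1 (p. 3)]; among simple groups "the alternating groups are the only simple groups left that could yield `ω = 2` via a triple product property construction. The representation-theoretic argument fails in this case, since `A_n` has an irreducible representation of dimension `n − 1` but `|A_n| = n!/2`" (kernel: `secondCharDegree_alternatingGroup_le`, `2 ≤ n(A_n) ≤ n − 1`, and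 `secondCharDegree_alternatingGroup_lt_rpow` / `alternatingGroup_not_cor33_hypothesis`, for every `c, δ > 0` eventually `n(A_n) < c|A_n|^δ`, so Cor. 3.3 is inapplicable to `(A_n)` — `QuasirandomBarrierPowersAlternating.lean`, 2026-08-27) [cite: BlasiakCohnGrochowPrattUmans2023, §5 (p. 12)].
scope_caveats: (a) Thm. 3.2 / Cor. 3.3 / Cor. 3.5 concern single TPP triples (not simultaneous/STPP constructions — the paper never mentions the STPP) and bound `|S||T||U|` only; the passage to "no `ω = 2`" is the necessity of the packing bound for Thm. 2.2 (§2), and Cor. 3.4's second half is specific to Lie type (it "is more subtle … since it does not simply amount to a failure to meeting the packing bound") [cite: BlasiakCohnGrochowPrattUmans2023, §2 and Cor. 3.4]; AUDIT (2026-08-15): the printed STPP gap is only a gap in print for PERFECT groups — the Fourier proof of Thm. 3.2 goes through for STPP families (CKSU Def. 5.1, `SimultaneousTPP`) once the trivial character is the only linear one, giving `P_AB P_BC P_CA ≤ |G| ∑|Aᵢ||Bᵢ||Cᵢ| + |G|^{3/2}(P_AB P_BC P_CA)^{1/2}/n(G)^{1/2}` (`P_AB = ∑|Aᵢ||Bᵢ|`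 etc.; `BCGPU2023_thm32_stpp`, proved in `QuasirandomBarrierSTPP.lean`) and hence `∑ᵢ(|Aᵢ||Bᵢ||Cᵢ|)^{2/3} ≤ max(√2|G|^{3/4}, 4^{1/3}|G|/n(G)^{1/3})` (`BCGPU2023_thm32_stpp.sum_rpow_two_thirds_le`), against the STPP packing bound `∑ᵢ(|Aᵢ||Bᵢ||Cᵢ|)^{2/3} ≥ |G|^{1−o(1)}` that `ω = 2` via CKSU Thm. 5.5 needs — so STPP constructions in perfect groups with `n(G) ≥ Ω(|G|^δ)` (`SL(n,q)`, simple groups of Lie type of bounded rank) are excluded as well; for one-dimensional characters other than the trivial one the sign step of the printed proof ("`π(S)π(S⁻¹) = |π(S)|²` … a nonnegative real number") fails for families (the term is a product of three complex numbers), so groups with `|G|^{Ω(1)}` linear characters (`GL(2,q)`, `𝔽_q^× × SL(2,q)`) are covered for STPP only through the direct-product/abelian-quotient heuristics, not by a theorem, while `|G : G'| = |G|^{o(1)}` reduces to `G'` [cite: BlasiakCohnGrochowPrattUmans2023, Thm. 3.2 (proof)]; (b) Cor. 3.4 is not a Lean statement in THIS file (Mathlib has no general notion of finite group of Lie type); for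 the type-`A` families `SL(n, q)`, `PSL(n, q)` — every `n ≥ 2`, every `q`, one absolute `ε`, in the effective reading "Thm. 2.2's inequality holds at `w = 2 + ε`" — it is the named fact `BCGPU2023_cor34_typeA` (`QuasirandomBarrierLieType.lean`), PROVED as `BCGPU2023_cor34_typeA_holds` (`QuasirandomBarrierLieTypeProofs.lean`, from Landazuri–Seitz Lemma 3.1 for `SL_n(𝔽_q)`, proved in `SLnMinimalCharacterDegree.lean`, and `k(GL_n(q)) ≤ (2q)ⁿ`, proved in `GLnClassNumberBound.lean`) [cite: LandazuriSeitz1974, Lemma 3.1]; the paper's `GL(n, q)` remarks of §3.2 ("triples of subgroups in `GL(n,q)` with fixed `n` cannot meet the packing bound" and, footnote, "more generally, arbitrary subsets cannot meet the packing bound") are PROVED, together with the uniform statement "one `ε` for all `GL(n, q)`", in `QuasirandomBarrierGLn.lean` [cite: BlasiakCohnGrochowPrattUmans2023, §3.2 (paragraph and footnote before Cor. 3.8)]; type `C` (`Sp(2n, q) = Matrix.symplecticGroup (Fin n) 𝔽_q`, `PSp(2n, q)`) is the named fact `BCGPU2023_cor34_typeC` (`QuasirandomBarrierLieTypeC.lean`,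 statement only; its bounded-rank half — one `ε(N)` for all `Sp(2n,q)`, `PSp(2n,q)` with `n ≤ N` — is PROVED as `BCGPU2023_noCertificate_Sp_rank_le`, and the fact is reduced to the class-number input `k(Sp(2n,q)) ≤ q^{5n}` alone by `BCGPU2023_cor34_typeC_of_classNumber`, `QuasirandomBarrierLieTypeCOfClassNumber.lean`, with the weak Landazuri–Seitz bound `n(Sp(2n,q)) ≥ q^{n−1} − 1` proved in `SpMinimalCharacterDegree.lean`) [cite: LandazuriSeitz1974, §1 (table, p. 419)]; the other families (`SU`, `SO`/`Ω`, exceptional, Suzuki–Ree) have no Mathlib carrier; Cor. 3.4 holds also "for simple groups that are quotients of groups of Lie type by their centers" [cite: BlasiakCohnGrochowPrattUmans2023, Cor. 3.4 (remark following the proof)]; (c) `n(G)` is defined through the tree's `charDegrees` (a `Nat.sInf`, junk `0` for abelian `G`, where Thm. 3.2 is not asserted); (d) the constant `ε` of Cor. 3.4 is not made explicit in print; (e) "group of Lie type" in Cor. 3.4 must be read as `G^F` for a SIMPLE algebraic group `G` (equivalently a bounded number of simple factors) and its quotients by the centre — the paper's footnote 2 says "the fixed points of a Steinberg endomorphism in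 a semisimple algebraic group" and lists `SL(n,q)`, `SU(n,q)`, `SO(2n+1,q)`, `Sp(2n,q)`, `SO^±(2n,q)`, but the printed proof uses `n(G) ≥ Ω(q^r)` (Landazuri–Seitz) and `O(q^r)` conjugacy classes (Fulman–Guralnick) with ABSOLUTE constants, true for simple `G` and false for semisimple `G = H^m` with `m → ∞` factors (`G^F = H(q)^m`: `n(G^F) = n(H(q)) = Θ(q^{r_H})` is independent of `m` while the rank is `m r_H` and the class number is `k(H(q))^m`); rerunning the printed crossing argument with these parameters bounds the attainable exponent only by `2 + O(1/m)`, so NO uniform `ε` follows for `{H(q)^m : q, m → ∞}` — this is exactly the direct-product escape and the authors' open problem of evasions_known, not a defect of Thm. 3.2 [cite: BlasiakCohnGrochowPrattUmans2023, §1 (footnote 2, p. 3), Cor. 3.4 (proof) and §5 (p. 12)].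
status: theorem (established) [cite: BlasiakCohnGrochowPrattUmans2023, Thm. 3.2 and Cor. 3.4] -/
def QuasirandomBarrier : Prop :=
  BCGPU2023_thm32 ∧ BCGPU2023_cor35

/-- Projection: Thm. 3.2. [cite: BlasiakCohnGrochowPrattUmans2023, Thm. 3.2] -/
theorem QuasirandomBarrier.thm32 (h : QuasirandomBarrier) : BCGPU2023_thm32 := h.1

/-- Projection: Cor. 3.5. [cite: BlasiakCohnGrochowPrattUmans2023, Cor. 3.5] -/
theorem QuasirandomBarrier.cor35 (h : QuasirandomBarrier) : BCGPU2023_cor35 := h.2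

/-- Under the barrier, a family with `n(G) ≥ c|G|^δ` (`c, δ > 0`) has all TPP triples of size
`|S||T||U| ≤ |G|^{3/2−δ/2}/√c + |G|`, i.e. it cannot meet the packing bound (Cor. 3.3).
[cite: BlasiakCohnGrochowPrattUmans2023, Cor. 3.3] -/
theorem QuasirandomBarrier.no_packing (h : QuasirandomBarrier) (G : Type) [Group G] [Fintype G]
    (hG : ∃ a b : G, a * b ≠ b * a) {c δ : ℝ} (hc : 0 < c)
    (hn : c * (Fintype.card G : ℝ) ^ δ ≤ secondCharDegree G) (S T U : Finset G)
    (hTPP : TripleProductProperty S T U) :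
    ((S.card * T.card * U.card : ℕ) : ℝ) ≤
      (Fintype.card G : ℝ) ^ (3 / 2 - δ / 2 : ℝ) / Real.sqrt c + Fintype.card G :=
  h.thm32.cor33 G hG hc hn S T U hTPP

end Catalogue

end Literature.Barriers.MatrixMultiplication
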